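import Mathlib
import Summits.PneNP.PneNP.Theorems.ConvexRankGatesLinAlgGateBlindTranspositionDoor
import Summits.PneNP.PneNP.Theorems.ConvexRankGatesLinAlgGateBlindReduction
import Summits.PneNP.PneNP.Theorems.ConvexRankGatesLinAlgGateBlindTermCollapse

/-!
# Route ConvexRankGates, crux `LinAlgGateBlind` (stmt-PneNP-10681): the crux text VERBATIM for the transposition sub-basis (supports)

`linAlgGateBlind_transpositionPerm`: the crux `Summit.PneNP.PneNP.Theses.ConvexRankGates.LinAlgGateBlind` with its
wide-gate class `Lin (m^c) = PERM_{m^c} ∪ GRANK_{m^c}` replaced by the sub-class `TransPERM(m^c)` of permutation-group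
membership gates on `≤ m^c` points whose generators are transpositions (or trivial) — i.e. monotone switching networks
with `≤ m^c` nodes as single gates — HOLDS unconditionally, with the same `δ = 1/8` and the same coupling of the gate
parameter to the size exponent `c`:

  `∃ δ ∈ (0, 1/2), ∀ c, ∀ᶠ m, ∀ C over {∧₂, ∨₂} ∪ TransPERM(m^c), C.size ≤ m^c → ¬ C.Computes CLIQUE(m, ⌈m^δ⌉)`.

Proof: the host `stub_wideApproxHost` (Razborov/Alon–Boppana along the program, wide monotone gates passed by
`GateApprox`) at the dense regime `stub_denseRegime c`, exactly as in the landed conditional reduction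
`linAlgGateBlind_of_sgAt`, with the single-gate property now PROVED for the class: a `TransPERM` gate fed with closed
families collapses to a `TransPERM` TERM gate (`isTermGate_transposition`: repeat `σ_i` on every atom of `A_i`, same `τ`,
same `d` — the PERM branch of `isTermGate_of_rewire` keeps transpositions transpositions), and the transposition door
`sgAt_transpositionPerm` supplies its small-clique DNF. This is the first unconditional instance of the crux's OWN TEXT at
gate parameter `m^c` for every `c` (the decoupled texts `linAlgGateBlind_decoupled'` need the gate parameter `⌊m^γ⌋`,
`γ < 7/8`). It is of course far from the crux: `TransPERM` omits the abelian (span-program) and general nonabelian PERM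
designs and all of GRANK. Sources: Razborov 1985; Alon–Boppana 1987, Thm. 2.1 and §3; S. M. Chan, A. Potechin, Theory
Comput. 10 (2014) (model). No new definitions; nothing is assumed. [folklore]
-/

-- `Summit.PneNP.PneNP.…` duplicates `PneNP` BY DESIGN (single-problem summit).
set_option linter.dupNamespace false

noncomputable section

namespace Summit.PneNP.PneNP.Theorems

open Finset Filter Literature.Computability.Complexity Razborov
open Summit.PneNP.PneNP.Cruxes.LinAlgGateBlind.DnfInvariantWideGatesSeeSmallCliques

/-- **Term collapse for the transposition class** (the PERM branch of `isTermGate_of_rewire`): a `TransPERM(s)` gate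
fed with the small-clique DNFs `⌈A_i⌉`, `A_i ⊆ 𝒱(l)`, is ONE `TransPERM(s)` term gate over the atoms `X ∈ ⋃ A_i`
(repeat `σ_i` on every new wire `(i, X)`; transpositions stay transpositions). [folklore] -/
theorem isTermGate_transposition (m s l : ℕ) (g : GateFn) (A : Fin g.1 → Finset (Finset (Fin m)))
    (hA : ∀ i, A i ⊆ smallSets (Fin m) l)
    (hg : ∃ d : ℕ, d ≤ s ∧ ∃ (σ : Fin g.1 → Equiv.Perm (Fin d)) (τ : Equiv.Perm (Fin d)),
      (∀ i, σ i = 1 ∨ (σ i).IsSwap) ∧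
        ∀ v : Fin g.1 → Bool, g.2 v = true ↔ τ ∈ Subgroup.closure (σ '' {i | v i = true})) :
    IsTermGate m (fun g' : GateFn => ∃ d : ℕ, d ≤ s ∧
      ∃ (σ : Fin g'.1 → Equiv.Perm (Fin d)) (τ : Equiv.Perm (Fin d)), (∀ i, σ i = 1 ∨ (σ i).IsSwap) ∧
        ∀ v : Fin g'.1 → Bool, g'.2 v = true ↔ τ ∈ Subgroup.closure (σ '' {i | v i = true})) l
      fun x => g.2 fun i => acceptsB (A i) x := by
  classical
  obtain ⟨d, hd, σ, τ, hσ, hgv⟩ := hg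
  set e := Fintype.equivFin (Σ i : Fin g.1, {X // X ∈ A i})
  refine ⟨⟨_, fun w => decide (τ ∈ Subgroup.closure ((fun a => σ (e.symm a).1) '' {a | w a = true}))⟩,
    ⟨d, hd, fun a => σ (e.symm a).1, τ, fun a => hσ _, fun w => decide_eq_true_iff⟩,
    fun a => ((e.symm a).2 : Finset (Fin m)), fun a => hA _ (e.symm a).2.2, fun x => ?_⟩
  change g.2 (fun i => acceptsB (A i) x) =
    decide (τ ∈ Subgroup.closure ((fun a => σ (e.symm a).1) '' {a | atomB ((e.symm a).2 : Finset (Fin m)) x = true}))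
  rw [Bool.eq_iff_iff, hgv, decide_eq_true_iff,
    image_rewire_eq (fun a => (e.symm a).1) σ (acceptsB_eq_true_iff_exists_atom A e x)]

/-- **The crux text for the transposition sub-basis, unconditionally** (`δ = 1/8`; registered ∀-form). For every `c`,
eventually in `m`, no circuit of size `≤ m^c` over `{∧₂, ∨₂} ∪ TransPERM(m^c)` computes `CLIQUE(m, ⌈m^{1/8}⌉)`: host
`stub_wideApproxHost` at `stub_denseRegime c` with plucking `stub_pluckingBound`, trimming `card_errPos_le_wide`, and
for the wide gates `isTermGate_transposition` + the door `sgAt_transpositionPerm` (re-closed, one more pluck).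
[folklore] -/
theorem linAlgGateBlind_transpositionPerm : ∃ δ : ℝ, 0 < δ ∧ δ < 1 / 2 ∧ ∀ c : ℕ, ∀ᶠ m : ℕ in atTop, ∀ C : Circuit (KEdge m), C.IsOver ({GateFn.and 2, GateFn.or 2} ∪ {g | ∃ d : ℕ, d ≤ m ^ c ∧ ∃ (σ : Fin g.1 → Equiv.Perm (Fin d)) (τ : Equiv.Perm (Fin d)), (∀ i, σ i = 1 ∨ (σ i).IsSwap) ∧ ∀ v : Fin g.1 → Bool, g.2 v = true ↔ τ ∈ Subgroup.closure (σ '' {i | v i = true})}) → C.size ≤ m ^ c → ¬ C.Computes (cliqueFn m ⌈(m : ℝ) ^ δ⌉₊) := by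
  refine ⟨1 / 8, by norm_num, by norm_num, fun c => ?_⟩
  filter_upwards [stub_denseRegime c, sgAt_transpositionPerm c] with m hR hP C hC hsize
  obtain ⟨hl, hr, hkm, hq0, hq1, hpl, hand, heps, hclq, hhalf⟩ := hR
  have hε : 0 ≤ epsOf c m := epsOf_nonneg c m
  refine stub_wideApproxHost m (kOf m) (rOf c m) (lOf m) (m ^ c) (qOf m) (epsOf c m) (2 * epsOf c m)
    {g | ∃ d : ℕ, d ≤ m ^ c ∧ ∃ (σ : Fin g.1 → Equiv.Perm (Fin d)) (τ : Equiv.Perm (Fin d)),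
      (∀ i, σ i = 1 ∨ (σ i).IsSwap) ∧
        ∀ v : Fin g.1 → Bool, g.2 v = true ↔ τ ∈ Subgroup.closure (σ '' {i | v i = true})}
    hr hl hkm hq0 hq1 hε (mul_nonneg (by norm_num) hε)
    (fun g hg => (isPermGate_of_transposition hg).monotone) ?_ ?_ ?_ ?_ ?_ C hC hsize
  · -- (∨): plucking within budget
    intro A B hA hB
    calc prob (qOf m) (fun x : KEdge m → Bool =>
          Accepts (closure (rOf c m) (lOf m) (A ∪ B)) x ∧ ¬ Accepts (A ∪ B) x)
        ≤ (#(smallSets (Fin m) (lOf m)) : ℝ) * (1 - qOf m ^ ((lOf m).choose 2)) ^ rOf c m :=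
          stub_pluckingBound m (rOf c m) (lOf m) (qOf m) hq0 hq1 (A ∪ B) (union_subset hA.subset hB.subset)
      _ ≤ epsOf c m := hpl
      _ ≤ 2 * epsOf c m := by linarith
  · -- (∧): trimming within budget
    intro A B hA hB
    calc (#(errPos (kOf m) A B) : ℝ)
        ≤ ((((rOf c m - 1) ^ lOf m) ^ 2 * (m - (lOf m + 1)).choose (kOf m - (lOf m + 1)) : ℕ) : ℝ) := by
          exact_mod_cast card_errPos_le_wide hr hA hB
      _ ≤ epsOf c m * (m.choose (kOf m) : ℝ) := hand
  · -- wide gates: collapse to a transposition term gate, apply the door, re-close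
    intro g hg A hA
    have hsub : ∀ i, A i ⊆ smallSets (Fin m) (lOf m) := fun i => (hA i).subset
    obtain ⟨𝒜, h𝒜, hlost, hgain⟩ := hP _ (isTermGate_transposition m (m ^ c) (lOf m) g A hsub hg)
    refine ⟨closure (rOf c m) (lOf m) 𝒜, isClosedFamily_closure _ _ _, ?_, ?_⟩
    · calc (#(lostPos m (kOf m) (fun x => g.2 fun i => acceptsB (A i) x)
            (closure (rOf c m) (lOf m) 𝒜)) : ℝ)
          ≤ (#(lostPos m (kOf m) (fun x => g.2 fun i => acceptsB (A i) x) 𝒜) : ℝ) := by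
            exact_mod_cast card_le_card (lostPos_anti' _ (subset_closure h𝒜))
        _ ≤ epsOf c m * (m.choose (kOf m) : ℝ) := hlost
    · calc gainedNeg m (qOf m) (fun x => g.2 fun i => acceptsB (A i) x) (closure (rOf c m) (lOf m) 𝒜)
          ≤ gainedNeg m (qOf m) (fun x => g.2 fun i => acceptsB (A i) x) 𝒜 +
              prob (qOf m) (fun x : KEdge m → Bool =>
                Accepts (closure (rOf c m) (lOf m) 𝒜) x ∧ ¬ Accepts 𝒜 x) :=
            gainedNeg_le_add' hq0 hq1 _ _ _
        _ ≤ epsOf c m + (#(smallSets (Fin m) (lOf m)) : ℝ) * (1 - qOf m ^ ((lOf m).choose 2)) ^ rOf c m :=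
            add_le_add hgain (stub_pluckingBound m (rOf c m) (lOf m) (qOf m) hq0 hq1 𝒜 h𝒜)
        _ ≤ 2 * epsOf c m := by linarith
  · -- positive-side budget: `m^c ε ≤ 1/16 < 1`
    exact lt_of_le_of_lt heps (by norm_num)
  · -- negative-side budget: `2 m^c ε + Pr[clique] ≤ 1/8 + 1/4 < 1/2 ≤ q^{C(l,2)}`
    have h2 : ((m ^ c : ℕ) : ℝ) * (2 * epsOf c m) = 2 * (((m ^ c : ℕ) : ℝ) * epsOf c m) := by ring
    rw [h2]
    linarith

end Summit.PneNP.PneNP.Theorems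

end
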